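import Summits.CriticalPhenomena.PercolationContinuityZ3.Theorems.Transplant.KNParaChainLocN
import Summits.CriticalPhenomena.PercolationContinuityZ3.Theorems.Transplant.SkelPhiParaRunFrameW
import HarnessLib

/-!
# N1 (the `{±1}` node), LEVEL 1, (C) column file (C-N7): THE SIGNED u-ROUNDS IN THE RUN FRAME — phase 2 of the (C) corridor as the localisation record
# `Skelφ.xLocPrm n ℓ h e W L0 N : ChainPara.LocPrm` (stride `n` exactly, pieces `⌊nℓ/U⌋ + 1`, link box `n × (⌊3nℓ/U⌋ + 1)` — p1-g11's `xPrmW` numbers —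
# transverse window `W`, siting slack `e`, start half-width `L0`), read in the FIXED frame `runX φ c₀ n h 1` with the stride sign PER WALKER
# `σ_w = LocPrm.dir (runX t 0)` (towards the centre) and the piece `τ = σ_w · LocPrm.steerT σ_w (runX t 1)`; the two LEVEL-1 facts the route datum
# consumes: **`runX_mem_locRegion_of_link`** (`w ∈ pgramPrism t n h (3ℓ) R ⇒ runX w ∈ region k`) and **`runX_mem_locCore_succ_of_piece`**
# (`w ∈ pgSideHalfW t n h ℓ R σ_w (σ_w·τ₀) ⇒ runX w ∈ core (k+1)`) — twins of p1's `runX_mem_region_of_link/_core_succ_of_piece` (SkelPhiParaRunChain) for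
# the localisation rounds, where the stride sign is NOT the frame sign.

builds on p205010 (kernel theorem, internal audit signed; external expert review pending) — nothing in this file uses p205010; nothing here is a
claim about the open node `SamePDropOfSkeletonNeg`.
Lane `prim-bschramm`, seat `prim-bschramm-p5` (gen 8; (C) lineage; C-FUNNEL.md §2 phase 2); helper file (`--supports stmt-CriticalPhenomena-4575`).
* §1 `xLocPrm`, `xLocPrm_ok` (`e ≤ n`, `⌊nℓ/U⌋ + 1 ≤ W`), `xLocSched := (xLocPrm …).scheduleN 0 0 _`, `mem_xLocSched_enl_iff`;
* §2 `landing_runX_W_signed` (a `σ_w`-stride read in the frame of sign `1`: `σ_w·Δ₀ = n`, `σ_w·Δ₁` in the piece of sign `σ_w·τ`);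
* §3 **`runX_mem_locRegion_of_link`**, **`runX_mem_locCore_succ_of_piece`**.
[cite: KozmaNitzan2024, §4 Lemma 11 (pp. 22–23), Lemma 12 (pp. 23–25)] [cite: MartineauTassion2017, §4.3 Lemma 4.2]
-/

noncomputable section

namespace Summit.CriticalPhenomena.PercolationContinuityZ3.Theorems.Transplant

namespace Skelφ

open Literature.Probability.Percolation Literature.Probability.LatticeModels SimpleGraph
open Literature.Probability.Percolation.KozmaNitzan.Cells (oth)
open ChainPlanar ChainPara

variable {V : Type} {G : SimpleGraph V} {φ : V → Site 2}

/-! ## §1 The u-round record in window units -/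

/-- **Phase 2 of the (C) corridor: signed u-rounds in window units** — stride exactly `n` along `α`, pieces `⌊nℓ/U⌋ + 1`, transverse window `W`, siting slack
`e`, link box `n × (⌊3nℓ/U⌋ + 1)`, start half-width `L0`, rounds `0..N`. [cite: KozmaNitzan2024, §4 Lemma 12 (pp. 23–25)] -/
def xLocPrm (n ℓ : ℕ) (h : ℤ) (e W L0 N : ℕ) : LocPrm where
  sLo := n
  sHi := n
  Pp := n * ℓ / shearUnit n h + 1
  Pm := n * ℓ / shearUnit n h + 1
  W := W
  e := e
  La := n
  Lb := 3 * (n * ℓ) / shearUnit n h + 1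
  L0 := L0
  N := N

/-- Admissibility of the u-round record: `e ≤ n` and `⌊nℓ/U⌋ + 1 ≤ W`. [folklore] -/
theorem xLocPrm_ok {n ℓ : ℕ} {h : ℤ} {e W : ℕ} (he : e ≤ n) (hW : n * ℓ / shearUnit n h + 1 ≤ W) (L0 N : ℕ) : LocOK (xLocPrm n ℓ h e W L0 N) where
  hs0 := by simp [xLocPrm]
  hs := le_rfl
  hsL := by simp [xLocPrm]
  hPp := hW
  hPm := hW
  he := by simp only [xLocPrm]; exact_mod_cast he

/-- The pieces, link box and stride of `xLocPrm` are those of p1-g11's `xPrmW`. [folklore] -/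
theorem xLocPrm_fields (n ℓ : ℕ) (h : ℤ) (e W L0 N R' q N' : ℕ) :
    (xLocPrm n ℓ h e W L0 N).La = (xPrmW n ℓ h R' q N').La ∧ (xLocPrm n ℓ h e W L0 N).Lb = (xPrmW n ℓ h R' q N').Lb ∧
    (xLocPrm n ℓ h e W L0 N).Pp = (xPrmW n ℓ h R' q N').Pp ∧ (xLocPrm n ℓ h e W L0 N).Pm = (xPrmW n ℓ h R' q N').Pm ∧
    (xLocPrm n ℓ h e W L0 N).sLo = n ∧ (xLocPrm n ℓ h e W L0 N).sHi = n := ⟨rfl, rfl, rfl, rfl, rfl, rfl⟩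

/-- Membership in the `e`-enlarged core `k` of the u-round schedule (axis `0`, centre `0`) = `InEnl k (y 0) (y 1)`. [folklore] -/
theorem mem_xLocSched_enl_iff {P : LocPrm} (hP : LocOK P) {k : ℕ} {y : Site 2} :
    y ∈ Finset.Icc ((P.scheduleN 0 0 hP).lo k - (((P.scheduleN 0 0 hP).R' : ℕ) : Site 2)) ((P.scheduleN 0 0 hP).hi k + (((P.scheduleN 0 0 hP).R' : ℕ) : Site 2)) ↔
      P.InEnl k (y 0) (y 1) := by
  show y ∈ Finset.Icc (dLo 0 1 0 (-P.L k) (P.L k) (-P.Wk k) (P.Wk k) - ((P.e : ℕ) : Site 2))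
      (dHi 0 1 0 (-P.L k) (P.L k) (-P.Wk k) (P.Wk k) + ((P.e : ℕ) : Site 2)) ↔ _
  rw [dBox_enlarge (Or.inl rfl), LocPrm.mem_enlarge_iff]
  have h01 : oth (0 : Fin 2) = 1 := by decide
  simp [h01]

/-! ## §2 A signed stride read in the frame of sign `1` -/

/-- **A `σ_w`-stride's landing in the run frame of sign `1`**: `w ∈ pgSideHalfW t n h ℓ R σ_w τ'` gives `σ_w·(runX w 0 − runX t 0) = n` and, with
`J := β′_t(w)` (`0 ≤ τ'·J ≤ nℓ`), `σ_w·(runX w 1 − runX t 1)` in the piece `[0, ⌊nℓ/U⌋+1]` of sign `σ_w·τ'` (resp. `[−(⌊nℓ/U⌋+1), 0]`).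
[cite: MartineauTassion2017, §3.2 Lemma 3.5, §4.3 Lemma 4.2] -/
theorem landing_runX_W_signed [G.LocallyFinite] {n : ℕ} (hn : 1 ≤ n) (c₀ : V) (h : ℤ) {σw τ' : ℤ} (hσ : σw = 1 ∨ σw = -1) (hτ : τ' = 1 ∨ τ' = -1)
    {t w : V} {ℓ R : ℕ} (hw : w ∈ pgSideHalfW G φ t n h ℓ R σw τ') (e W L0 N : ℕ) :
    σw * (runX φ c₀ n h 1 w 0 - runX φ c₀ n h 1 t 0) = n ∧
      (xLocPrm n ℓ h e W L0 N).InPiece (σw * τ') (σw * (runX φ c₀ n h 1 w 1 - runX φ c₀ n h 1 t 1)) := by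
  have hσσ : σw * σw = 1 := by rcases hσ with rfl | rfl <;> simp
  obtain ⟨-, hC, hα, hτβ⟩ := (mem_pgSideHalfW G φ).1 hw
  obtain ⟨-, hβ⟩ := (mem_pgramCyl (φ := φ)).1 hC
  rw [abs_le] at hβ
  refine ⟨by rw [runX_sub_runX_zero, one_mul, hα, ← mul_assoc, hσσ, one_mul], ?_⟩
  -- the floored transverse difference from the bounds on `J := β′_t(w)`
  have hPp : (xLocPrm n ℓ h e W L0 N).Pp = n * ℓ / shearUnit n h + 1 := rfl
  have hPm : (xLocPrm n ℓ h e W L0 N).Pm = n * ℓ / shearUnit n h + 1 := rfl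
  have hc := shearUnit_pos hn h
  set J := shearCoord φ t n h w with hJ
  set Δ₁ := runX φ c₀ n h 1 w 1 - runX φ c₀ n h 1 t 1 with hΔ₁
  have eJ : shearCoord φ c₀ n h w - shearCoord φ c₀ n h t = J := by rw [hJ, shearCoord_sub_origin φ c₀ t n h w]
  have hΔ₁' : Δ₁ = shearCoord φ c₀ n h w / (shearUnit n h : ℤ) - shearCoord φ c₀ n h t / (shearUnit n h : ℤ) := by
    rw [hΔ₁, runX_one, runX_one, one_mul, one_mul]
  have kpos : 0 ≤ J → 0 ≤ Δ₁ ∧ Δ₁ ≤ (n : ℤ) * ℓ / (shearUnit n h : ℤ) + 1 := fun hJ0 => by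
    obtain ⟨hl, hu⟩ := runX_sub_runX_one_bounds hn φ c₀ h 1 t w (a := 0) (b := (n : ℤ) * ℓ) (by rw [one_mul]; exact hJ0)
      (by rw [one_mul]; exact hβ.2)
    rw [Int.zero_ediv] at hl
    exact ⟨hl, hu⟩
  have kneg : J ≤ 0 → -((n : ℤ) * ℓ / (shearUnit n h : ℤ)) - 1 ≤ Δ₁ ∧ Δ₁ ≤ 0 := fun hJ0 => by
    obtain ⟨hl, -⟩ := runX_sub_runX_one_bounds hn φ c₀ h 1 t w (a := -((n : ℤ) * ℓ)) (b := 0) (by rw [one_mul]; exact hβ.1)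
      (by rw [one_mul]; exact hJ0)
    have hneg : -((n : ℤ) * ℓ / (shearUnit n h : ℤ)) - 1 ≤ -((n : ℤ) * ℓ) / (shearUnit n h : ℤ) := by
      have h2 := ediv_sub_ediv_le_add_one (x := 0) (y := -((n : ℤ) * ℓ)) (b := (n : ℤ) * ℓ) hc (by simp)
      rw [Int.zero_ediv, zero_sub] at h2
      linarith
    refine ⟨hneg.trans hl, ?_⟩
    rw [hΔ₁']
    have hmono := Int.ediv_le_ediv hc (show shearCoord φ c₀ n h w ≤ shearCoord φ c₀ n h t by linarith [eJ])
    linarith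
  rw [ChainPara.LocPrm.InPiece, hPp, hPm]
  push_cast
  constructor
  · -- `σ_w τ' = 1`: the signed transverse offset lies in `[0, Pp]`
    intro h1
    rcases hσ with rfl | rfl
    · rcases hτ with rfl | rfl
      · -- (1, 1): `J ≥ 0`
        simp only [one_mul] at hτβ ⊢
        exact kpos hτβ
      · norm_num at h1
    · rcases hτ with rfl | rfl
      · norm_num at h1
      · -- (−1, −1): `J ≤ 0`
        have hJ0 : J ≤ 0 := by rw [neg_mul, one_mul, neg_nonneg] at hτβ; exact hτβ
        obtain ⟨hl, hu⟩ := kneg hJ0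
        constructor <;> linarith
  · -- `σ_w τ' = −1`: the signed transverse offset lies in `[−Pm, 0]`
    intro h1
    rcases hσ with rfl | rfl
    · rcases hτ with rfl | rfl
      · norm_num at h1
      · -- (1, −1): `J ≤ 0`
        have hJ0 : J ≤ 0 := by rw [neg_mul, one_mul, neg_nonneg] at hτβ; exact hτβ
        simp only [one_mul]
        obtain ⟨hl, hu⟩ := kneg hJ0
        constructor <;> linarith
    · rcases hτ with rfl | rfl
      · -- (−1, 1): `J ≥ 0`
        simp only [one_mul] at hτβ
        obtain ⟨hl, hu⟩ := kpos hτβ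
        constructor <;> linarith
      · norm_num at h1

/-! ## §3 Link region into the region, steered piece into the next core -/

/-- **The link region of a seed centre in the enlarged core is read into the region** (u-rounds). [cite: KozmaNitzan2024, §4 Lemma 11 (p. 22)] -/
theorem runX_mem_locRegion_of_link {n ℓ : ℕ} {h : ℤ} {e W : ℕ} (hn : 1 ≤ n) (he : e ≤ n) (hW : n * ℓ / shearUnit n h + 1 ≤ W) (L0 N : ℕ) (c₀ : V)
    {k : ℕ} {t w : V} {R : ℕ}
    (ht : runX φ c₀ n h 1 t ∈ Finset.Icc (((xLocPrm n ℓ h e W L0 N).scheduleN 0 0 (xLocPrm_ok he hW L0 N)).lo k -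
        ((((xLocPrm n ℓ h e W L0 N).scheduleN 0 0 (xLocPrm_ok he hW L0 N)).R' : ℕ) : Site 2))
      (((xLocPrm n ℓ h e W L0 N).scheduleN 0 0 (xLocPrm_ok he hW L0 N)).hi k + ((((xLocPrm n ℓ h e W L0 N).scheduleN 0 0 (xLocPrm_ok he hW L0 N)).R' : ℕ) : Site 2)))
    (hw : w ∈ pgramPrism G φ t n h (3 * ℓ) R) :
    runX φ c₀ n h 1 w ∈ ((xLocPrm n ℓ h e W L0 N).scheduleN 0 0 (xLocPrm_ok he hW L0 N)).region k := by
  have ht' := (mem_xLocSched_enl_iff (xLocPrm_ok he hW L0 N)).1 ht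
  obtain ⟨h0, h1⟩ := link_runX hn c₀ h (Or.inl rfl) hw e 0 N
  rw [LocPrm.scheduleN_region, LocPrm.mem_pregion_iff]
  have h01 : oth (0 : Fin 2) = 1 := by decide
  simp only [Pi.zero_apply, sub_zero, h01]
  exact LocPrm.inRegion_of_link ht' h0 h1

/-- **THE STEERED SIDE HALF OF THE CENTRE-BOUND STRIDE IS READ INTO THE NEXT CORE** (u-rounds): with `σ_w := dir (runX t 0)` (towards the centre) and
`τ₀ := steerT σ_w (runX t 1)`, every `w ∈ pgSideHalfW t n h ℓ R σ_w (σ_w·τ₀)` has `runX w ∈ core (k+1)`.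
[cite: KozmaNitzan2024, §4 Lemma 12 (pp. 23–25)] [cite: MartineauTassion2017, §4.3 Lemma 4.2] -/
theorem runX_mem_locCore_succ_of_piece [G.LocallyFinite] {n ℓ : ℕ} {h : ℤ} {e W : ℕ} (hn : 1 ≤ n) (he : e ≤ n) (hW : n * ℓ / shearUnit n h + 1 ≤ W)
    (L0 N : ℕ) (c₀ : V) {k : ℕ} {t w : V} {R : ℕ}
    (ht : runX φ c₀ n h 1 t ∈ Finset.Icc (((xLocPrm n ℓ h e W L0 N).scheduleN 0 0 (xLocPrm_ok he hW L0 N)).lo k -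
        ((((xLocPrm n ℓ h e W L0 N).scheduleN 0 0 (xLocPrm_ok he hW L0 N)).R' : ℕ) : Site 2))
      (((xLocPrm n ℓ h e W L0 N).scheduleN 0 0 (xLocPrm_ok he hW L0 N)).hi k + ((((xLocPrm n ℓ h e W L0 N).scheduleN 0 0 (xLocPrm_ok he hW L0 N)).R' : ℕ) : Site 2)))
    (hw : w ∈ pgSideHalfW G φ t n h ℓ R (LocPrm.dir (runX φ c₀ n h 1 t 0))
      (LocPrm.dir (runX φ c₀ n h 1 t 0) * LocPrm.steerT (LocPrm.dir (runX φ c₀ n h 1 t 0)) (runX φ c₀ n h 1 t 1))) :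
    runX φ c₀ n h 1 w ∈ ((xLocPrm n ℓ h e W L0 N).scheduleN 0 0 (xLocPrm_ok he hW L0 N)).core (k + 1) := by
  set σw := LocPrm.dir (runX φ c₀ n h 1 t 0) with hσw
  set τ₀ := LocPrm.steerT σw (runX φ c₀ n h 1 t 1) with hτ₀
  have hσ : σw = 1 ∨ σw = -1 := LocPrm.dir_eq_or _
  have hτ : τ₀ = 1 ∨ τ₀ = -1 := LocPrm.steerT_eq_or _ _
  have hστ : σw * τ₀ = 1 ∨ σw * τ₀ = -1 := by rcases hσ with h1 | h1 <;> rcases hτ with h2 | h2 <;> simp [h1, h2]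
  have hσσ : σw * σw = 1 := by rcases hσ with h1 | h1 <;> simp [h1]
  have ht' := (mem_xLocSched_enl_iff (xLocPrm_ok he hW L0 N)).1 ht
  obtain ⟨h0, hpc⟩ := landing_runX_W_signed hn c₀ h hσ hστ hw e W L0 N
  have hpiece : (xLocPrm n ℓ h e W L0 N).InPiece τ₀ (σw * (runX φ c₀ n h 1 w 1 - runX φ c₀ n h 1 t 1)) := by
    have eq : σw * (σw * τ₀) = τ₀ := by rw [← mul_assoc, hσσ, one_mul]
    rw [eq] at hpc; exact hpc
  rw [LocPrm.scheduleN_core, LocPrm.mem_pcore_iff]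
  have h01 : oth (0 : Fin 2) = 1 := by decide
  simp only [Pi.zero_apply, sub_zero, h01]
  have hdir : LocPrm.dir (runX φ c₀ n h 1 t 0 - 0) = σw := by rw [sub_zero]
  refine LocPrm.inCore_succ_of_landing (xLocPrm_ok he hW L0 N) (a := runX φ c₀ n h 1 t 0) (b := runX φ c₀ n h 1 t 1) ht' ?_ ?_ ?_
  · rw [h0]; exact le_rfl
  · rw [h0]; exact le_rfl
  · exact hpiece

end Skelφ

end Summit.CriticalPhenomena.PercolationContinuityZ3.Theorems.Transplant

end
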